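import Summits.NavierStokesRegularity.NavierStokesRegularity.Theses.PalasekTowerBreakdown

/-!
# NavierStokesRegularity — route `PalasekTowerBreakdown`, assembly

Settles `stmt-NavierStokesRegularity-19181` (assembly of route PalasekTowerBreakdown):

  `EpisodeBase → EpisodeInduction → TaoForcedUniqueness → NavierStokesBreakdownR3`

(the three hypotheses are the route's items, inlined in the route decl
`PalasekTowerBreakdown.Assembly`). The hypothesis list is, in the same order, the hypothesis list
of the route's deciding theorem
`Summit.NavierStokesRegularity.NavierStokesRegularity.Theses.PalasekTowerBreakdown.closes`, whose
body is the register closer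
`Summit.NavierStokesRegularity.FluidComputer.PalasekTowerClayBridge.navierStokesBreakdownR3_of_episodesG`
(register v2.3′, `FluidComputer/PalasekTowerRegisterGlobal.lean`): K1G gives a pinned rigid quiet
schedule with a globally anchored stage at level 1, K2G continues it through every level, the tree
glues the chain into a `Realisation 1 TowerRates.wide`, rescales to every viscosity
(`PalasekStep2`) and, with Tao's forced unconditional uniqueness (W14) discharging the bridge's
uniqueness slot, concludes Clay (C) `NavierStokesBreakdownR3`. Nothing here is new mathematics:
the open content lives in the cruxes `EpisodeBase` / `EpisodeInduction` and the support item
`TaoForcedUniqueness` (a cited, unproved Literature fact). The candidate term was kernel-checked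
and attached to the item by refuter g9 (evidence `Proof_Assembly.lean`, sha16 48887e1c8e8e94f6).

WHAT THIS IS NOT: not NS — pure glue; no crux is inhabited here.
-/

-- `Summit.<Summit>.<Problem>` is the tree's mandated summit-side namespace (CONVENTIONS §2); for this
-- single-conjunct summit the two coincide, so the duplicate is deliberate.
set_option linter.dupNamespace false

namespace Summit.NavierStokesRegularity.NavierStokesRegularity.Theorems

open Summit.NavierStokesRegularity.NavierStokesRegularity.Theses

/-- Assembly of route PalasekTowerBreakdown (`stmt-NavierStokesRegularity-19181`):
`EpisodeBase → EpisodeInduction → TaoForcedUniqueness → NavierStokesBreakdownR3`.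
Pure logic: the route's deciding theorem `PalasekTowerBreakdown.closes` (= the register-v2.3′
closer `navierStokesBreakdownR3_of_episodesG`) applied to the three hypotheses. [folklore] -/
theorem palasekTowerBreakdown_assembly_proof : PalasekTowerBreakdown.Assembly := by
  unfold PalasekTowerBreakdown.Assembly
  -- buildfix 2026-08-26 (class (i) drift, proof-only): the route's deciding theorem `closes` was
  -- re-cut 2026-08-26T04:19Z to take only `EpisodeBase`/`EpisodeInduction` (Tao's forced uniqueness is
  -- discharged inside it), so the third hypothesis of `Assembly` is no longer consumed.
  -- buildfix #2 2026-08-26 (class (i) drift, proof-only; planner g18 draft): made INDEPENDENT of the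
  -- arity of the route's deciding theorem `closes` (re-cut again by the T1-round-2 mitigation to the
  -- binders `EpisodeBase` / `HeredityAtOne` / `HeredityFromTwo`): the register closers are cited by name.
  intro h₁ h₂ _hU
  exact Summit.NavierStokesRegularity.FluidComputer.PalasekTowerClayBridge.navierStokesBreakdownR3_of_step2_B _
    (Summit.NavierStokesRegularity.FluidComputer.PalasekTowerClayBridge.palasekStep2_of_episodesG h₁ h₂)

end Summit.NavierStokesRegularity.NavierStokesRegularity.Theorems
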